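import Summits.Ventures.PercRepro.ProfilePointedCircuitClassesFive

/-!
# PercRepro — THE BOTTOM-LEVEL PER-CIRCUIT CLAIM AT NULLITY 5, II: THE CLASS `#C = 3`, TYPE (ii) AND THE VALID POINTS
(p5, gen 37; `proofs/P5-GM1.md` §53(e); the nullity-4 template is `ProfilePointedCircuitClassesCore`)

For the class `#C = 3` on `#E = ρ(E) + 5`, `ρ(E) ≥ 7` (two free points, exactly as the class `#C = 2` at nullity 4):
`two_le_card_filter_valid_five` (at least two of the five points of `T := (E − x) ∖ V` lie off `cl(V − q')`) and
the type-(ii) injection `card_typeII_five_le` (a demand `W' = C + p' + q'` with `W' ∩ W = C` goes to the unit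
`(E − x) ∖ ((W' ∖ C) + t₁ + t₂ + t₃)`, `t₁` not a coloop of `X := E ∖ (W' ∖ C)`, `t₂` not a coloop of `X − t₁`).
-/

open scoped Matroid

namespace PercRepro.Cogirth

open Finset ThmH Skew Shadow Profile

variable {α : Type} [DecidableEq α] {N : Matroid α} [N.Finite]

section FiveCore

/-- **AT MOST TWO INVALID POINTS** (§53(e), the type (iii) of the class `#C = 3` at nullity 5): for a unit `V` of a class `C` with `x ∈ cl C`, a point
`q' ∈ V ∖ C` with `E − q'` spanning, and `T := (E − x) ∖ V` (five points), at least two points `t ∈ T` satisfy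
`t ∉ cl(V − q')` — otherwise `E − q' − t₅` lies in `cl(V − q')`, of rank `#V − 1`, while its rank is `≥ ρ(E) − 1`. -/
theorem two_le_card_filter_valid_five {x q' : α} {C V : Finset α} (hVg : V ⊆ gr N) (hVrk : rk N V = V.card)
    (_hxV : x ∉ V) (hCV : C ⊆ V) (hxC : x ∈ clF N C) (hq'V : q' ∈ V) (hq'C : q' ∉ C)
    (hq : rk N ((gr N).erase q') = rk N (gr N)) (hT5 : ((gr N).erase x \ V).card = 5)
    (hVcard : V.card + 6 = (gr N).card) (hn : (gr N).card = rk N (gr N) + 5) (hR : 7 ≤ rk N (gr N)) :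
    2 ≤ (((gr N).erase x \ V).filter (fun t => t ∉ clF N (V.erase q'))).card := by
  by_contra hlt
  have hlt : (((gr N).erase x \ V).filter (fun t => t ∉ clF N (V.erase q'))).card < 2 := Nat.lt_of_not_le hlt
  set T := (gr N).erase x \ V with hT
  set Tv := T.filter (fun t => t ∉ clF N (V.erase q')) with hTv
  -- a point `t₅ ∈ T` with `Tv ⊆ {t₅}`
  have hex : ∃ t₅ ∈ T, Tv ⊆ {t₅} := by
    rcases Tv.eq_empty_or_nonempty with hemp | ⟨t, ht⟩
    · obtain ⟨t, ht⟩ : T.Nonempty := card_pos.1 (by omega)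
      exact ⟨t, ht, by rw [hemp]; exact empty_subset _⟩
    · refine ⟨t, (mem_filter.1 ht).1, ?_⟩
      intro t' ht'
      rw [mem_singleton]
      have h2 : Tv.card ≤ 1 := by omega
      exact card_le_one.1 h2 t' ht' t ht
  obtain ⟨t₅, ht₅T, hTv₄⟩ := hex
  have ht₅g : t₅ ∈ gr N := (mem_erase.1 (mem_sdiff.1 ht₅T).1).2
  have ht₅V : t₅ ∉ V := (mem_sdiff.1 ht₅T).2
  have ht₅q : t₅ ≠ q' := fun h => ht₅V (h ▸ hq'V)
  have hxg : x ∈ gr N := clF_subset_gr C hxC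
  -- `E − q' − t₅ ⊆ cl(V − q')`
  have hVe : V.erase q' ⊆ gr N := (erase_subset _ _).trans hVg
  have hCVe : C ⊆ V.erase q' := by
    intro c hc
    rw [mem_erase]
    exact ⟨fun h => hq'C (h ▸ hc), hCV hc⟩
  have hsub : ((gr N).erase q').erase t₅ ⊆ clF N (V.erase q') := by
    intro a ha
    rw [mem_erase, mem_erase] at ha
    obtain ⟨hat, haq, hag⟩ := ha
    by_cases haV : a ∈ V
    · exact subset_clF_self_of_subset_gr hVe (mem_erase.2 ⟨haq, haV⟩)
    · by_cases hax : a = x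
      · rw [hax]
        exact mem_clF_of_subset hCVe hxC
      · have haT : a ∈ T := mem_sdiff.2 ⟨mem_erase.2 ⟨hax, hag⟩, haV⟩
        by_contra hacl
        have : a ∈ Tv := mem_filter.2 ⟨haT, hacl⟩
        exact hat (mem_singleton.1 (hTv₄ this))
  have h1 : rk N (((gr N).erase q').erase t₅) ≤ rk N (V.erase q') := by
    have := rk_le_rk_of_subset_finset (M := N) hsub
    rwa [rk_clF_eq_rk] at this
  have h2 : rk N (V.erase q') = V.card - 1 := by
    rw [rk_eq_card_of_subset_of_rk_eq_card (erase_subset _ _) hVrk, card_erase_of_mem hq'V]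
  have h3 : rk N ((gr N).erase q') ≤ rk N (((gr N).erase q').erase t₅) + 1 := by
    have e : insert t₅ (((gr N).erase q').erase t₅) = (gr N).erase q' :=
      insert_erase (mem_erase.2 ⟨ht₅q, ht₅g⟩)
    have := rk_insert_eq (M := N) ht₅g ((erase_subset _ _).trans (erase_subset _ _)) (e := t₅)
      (X := ((gr N).erase q').erase t₅)
    rw [e] at this
    rw [this]
    split_ifs <;> omega
  have h4 : rk N (gr N) ≤ rk N (((gr N).erase q').erase t₅) + 1 := hq ▸ h3
  have h5 : rk N (((gr N).erase q').erase t₅) ≤ V.card - 1 := h1.trans (le_of_eq h2)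
  have h6 : 5 ≤ V.card := by
    have := hn
    have := hVcard
    have := hR
    omega
  omega

/-- **THE TYPE-(ii) DEMANDS** (`W' ∩ W = C`): `W' ↦ (E − x) ∖ ((W' ∖ C) + t₁ + t₂ + t₃)` with `t₁ ∈ T` not a coloop of
`X := E ∖ (W' ∖ C)` and `t₂ ∈ T − t₁` not a coloop of `X − t₁`; the image meets `T` in two points and determines `W' ∖ C = V ∖ image`. -/
theorem card_typeII_five_le
    (hn : (gr N).card = rk N (gr N) + 5) (x : α) {C W V : Finset α} (Dv Uw : Finset (Finset α))
    (hC : C.card = 3) (hWcard : W.card = 5) (_hxV : x ∉ V) (hVg : V ⊆ gr N) (hVE : V ⊆ (gr N).erase x) (hVcard : V.card = (gr N).card - 6) (hVrk : rk N V = V.card)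
    (hCW : C ⊆ W) (hT5 : ((gr N).erase x \ V).card = 5) (hTg : (gr N).erase x \ V ⊆ gr N)
    (hTV : ∀ t ∈ (gr N).erase x \ V, t ∉ V) (hTW : ∀ t ∈ (gr N).erase x \ V, t ∉ W)
    (hdem' : ∀ W' ∈ Dv, C ⊆ W' ∧ W'.card = 5 ∧ W' ⊆ V ∧ rk N (gr N \ W') = (gr N \ W').card)
    (hspan' : ∀ W' ∈ Dv, ∀ S ⊆ W', rk N (gr N \ S) = rk N (gr N))
    (hunit' : ∀ T' : Finset α, T' ⊆ (gr N).erase x \ W → T'.card = 5 →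
      rk N (gr N) ≤ rk N (gr N \ T') + 1 → (gr N).erase x \ T' ∈ Uw) :
    (Dv.filter (fun W' => ¬ W' = W ∧ ¬ (W' ∩ W).card = 4)).card ≤
      (Uw.filter (fun V' => (V' ∩ ((gr N).erase x \ V)).card = 2)).card := by
  apply card_le_card_of_forall_subsingleton (fun W' V' => V \ V' = W' \ C)
  · intro W' hW'
    rw [mem_filter] at hW'
    obtain ⟨hW'Dv, hne, h4⟩ := hW'
    obtain ⟨hCW', hc', hsub', hcompl'⟩ := hdem' W' hW'Dv
    -- `W' ∩ W = C`: the intersection contains `C`, has at most `3` points unless `W' = W`, and is not `3`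
    have hint : W' ∩ W = C := by
      have hsubI : C ⊆ W' ∩ W := subset_inter hCW' hCW
      have hle5 : (W' ∩ W).card ≤ 5 := (card_le_card inter_subset_left).trans (le_of_eq hc')
      have hne5 : (W' ∩ W).card ≠ 5 := by
        intro h5
        apply hne
        have hWsub : W' ⊆ W := by
          have : W' ∩ W = W' := eq_of_subset_of_card_le inter_subset_left (by omega)
          rw [← this]; exact inter_subset_right
        exact eq_of_subset_of_card_le hWsub (by omega)
      have hge3 : 3 ≤ (W' ∩ W).card := hC ▸ card_le_card hsubI
      exact (eq_of_subset_of_card_le hsubI (by omega)).symm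
    have hPV : W' \ C ⊆ V := sdiff_subset.trans hsub'
    have hPW : ∀ a ∈ W' \ C, a ∉ W := by
      intro a ha haW
      have : a ∈ W' ∩ W := mem_inter.2 ⟨(mem_sdiff.1 ha).1, haW⟩
      rw [hint] at this
      exact (mem_sdiff.1 ha).2 this
    have hP2 : (W' \ C).card = 2 := by rw [card_sdiff_of_subset hCW']; omega
    -- `t₁ ∈ T` not a coloop of `E ∖ (W' ∖ C)`
    have hTX : (gr N).erase x \ V ⊆ gr N \ (W' \ C) := fun t ht =>
      mem_sdiff.2 ⟨hTg ht, fun h => hTV t ht (hPV h)⟩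
    have hrkX : rk N (gr N \ (W' \ C)) ≤ rk N ((gr N \ (W' \ C)) \ ((gr N).erase x \ V)) + 3 := by
      have h1 : rk N (gr N \ (W' \ C)) = rk N (gr N) := hspan' W' hW'Dv (W' \ C) sdiff_subset
      have h2 : V \ (W' \ C) ⊆ (gr N \ (W' \ C)) \ ((gr N).erase x \ V) := by
        intro a ha
        rw [mem_sdiff] at ha ⊢
        exact ⟨mem_sdiff.2 ⟨hVg ha.1, ha.2⟩, fun h => hTV a h ha.1⟩
      have h3 : rk N (V \ (W' \ C)) = (V \ (W' \ C)).card :=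
        rk_eq_card_of_subset_of_rk_eq_card sdiff_subset hVrk
      have h4 := rk_le_rk_of_subset_finset (M := N) h2
      rw [h3, card_sdiff_of_subset hPV, hVcard, hP2] at h4
      omega
    obtain ⟨t₁, ht₁T, ht₁⟩ := exists_not_coloop_of_five hTX hT5 hrkX
    -- `t₂ ∈ T − t₁` not a coloop of `X − t₁`
    have hX₁ : ((gr N).erase x \ V).erase t₁ ⊆ (gr N \ (W' \ C)).erase t₁ := by
      intro a ha
      rw [mem_erase] at ha ⊢
      exact ⟨ha.1, hTX ha.2⟩
    have hT₁4 : (((gr N).erase x \ V).erase t₁).card = 4 := by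
      rw [card_erase_of_mem ht₁T, hT5]
    have hrkX₁ : rk N ((gr N \ (W' \ C)).erase t₁) ≤
        rk N ((gr N \ (W' \ C)).erase t₁ \ ((gr N).erase x \ V).erase t₁) + 3 := by
      have e : (gr N \ (W' \ C)).erase t₁ \ ((gr N).erase x \ V).erase t₁ =
          (gr N \ (W' \ C)) \ ((gr N).erase x \ V) := by
        ext a
        constructor
        · intro ha
          rw [mem_sdiff, mem_erase] at ha
          obtain ⟨⟨hat, haX⟩, h⟩ := ha
          rw [mem_sdiff]
          exact ⟨haX, fun haT => h (mem_erase.2 ⟨hat, haT⟩)⟩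
        · intro ha
          rw [mem_sdiff] at ha
          obtain ⟨haX, haT⟩ := ha
          rw [mem_sdiff, mem_erase]
          refine ⟨⟨?_, haX⟩, fun h => haT (mem_erase.1 h).2⟩
          rintro rfl
          exact haT ht₁T
      rw [e, ht₁]
      exact hrkX
    obtain ⟨t₂, ht₂T₁, ht₂⟩ := exists_not_coloop_of_four hX₁ hT₁4 hrkX₁
    rw [mem_erase] at ht₂T₁
    obtain ⟨ht₂₁, ht₂T⟩ := ht₂T₁
    obtain ⟨t₃, ht₃T, ht₃₁₂⟩ := exists_mem_notMem_of_card_lt_card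
      (show ({t₁, t₂} : Finset α).card < ((gr N).erase x \ V).card by
        rw [card_pair (fun h => ht₂₁ h.symm)]; omega)
    rw [mem_insert, mem_singleton, not_or] at ht₃₁₂
    obtain ⟨ht₃₁, ht₃₂⟩ := ht₃₁₂
    have hc3 : ({t₁, t₂, t₃} : Finset α).card = 3 := by
      rw [card_insert_of_notMem, card_pair (fun h => ht₃₂ h.symm)]
      rw [mem_insert, mem_singleton, not_or]
      exact ⟨fun h => ht₂₁ h.symm, fun h => ht₃₁ h.symm⟩
    have hsubT : ({t₁, t₂, t₃} : Finset α) ⊆ (gr N).erase x \ V := by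
      intro a ha
      rw [mem_insert, mem_insert, mem_singleton] at ha
      rcases ha with rfl | rfl | rfl
      · exact ht₁T
      · exact ht₂T
      · exact ht₃T
    -- the hole `T' := (W' ∖ C) + t₁ + t₂ + t₃` and the unit `(E − x) ∖ T'`
    set T' := (W' \ C) ∪ {t₁, t₂, t₃} with hT'
    have hT'S : T' ⊆ (gr N).erase x \ W := by
      intro a ha
      rw [hT', mem_union] at ha
      rw [mem_sdiff]
      rcases ha with ha | ha
      · exact ⟨hVE (hPV ha), hPW a ha⟩
      · have haT := hsubT ha
        exact ⟨(mem_sdiff.1 haT).1, hTW _ haT⟩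
    have hT'5 : T'.card = 5 := by
      rw [hT', card_union_of_disjoint, hP2, hc3]
      rw [disjoint_left]
      intro a ha hb
      exact hTV _ (hsubT hb) (hPV ha)
    have hrkT' : rk N (gr N) ≤ rk N (gr N \ T') + 1 := by
      have e1 : gr N \ T' = (((gr N \ (W' \ C)).erase t₁).erase t₂).erase t₃ := by
        rw [hT']
        ext a
        simp only [mem_sdiff, mem_erase, mem_union, mem_insert, mem_singleton, not_or]
        tauto
      have h1 : rk N (gr N \ (W' \ C)) = rk N (gr N) := hspan' W' hW'Dv (W' \ C) sdiff_subset
      have ht₃X : t₃ ∈ ((gr N \ (W' \ C)).erase t₁).erase t₂ :=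
        mem_erase.2 ⟨ht₃₂, mem_erase.2 ⟨ht₃₁, hTX ht₃T⟩⟩
      have e2 : insert t₃ ((((gr N \ (W' \ C)).erase t₁).erase t₂).erase t₃) =
          ((gr N \ (W' \ C)).erase t₁).erase t₂ := insert_erase ht₃X
      have h2 := rk_insert_eq (M := N) (hTg ht₃T)
        ((erase_subset _ _).trans ((erase_subset _ _).trans ((erase_subset _ _).trans sdiff_subset)))
        (e := t₃) (X := (((gr N \ (W' \ C)).erase t₁).erase t₂).erase t₃)
      rw [e2] at h2
      rw [e1, ← h1, ← ht₁, ← ht₂, h2]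
      split_ifs <;> omega
    have hmem := hunit' T' hT'S hT'5 hrkT'
    refine ⟨(gr N).erase x \ T', ?_, ?_⟩
    · rw [mem_filter]
      refine ⟨hmem, ?_⟩
      have e : ((gr N).erase x \ T') ∩ ((gr N).erase x \ V) = ((gr N).erase x \ V) \ {t₁, t₂, t₃} := by
        rw [hT']
        ext a
        simp only [mem_inter, mem_sdiff, mem_union, mem_insert, mem_singleton, not_or]
        constructor
        · rintro ⟨⟨hax, haP, hat⟩, _, haV⟩
          exact ⟨⟨hax, haV⟩, hat⟩
        · rintro ⟨⟨hax, haV⟩, hat⟩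
          exact ⟨⟨hax, fun h => haV (hPV (mem_sdiff.2 h)), hat⟩, hax, haV⟩
      rw [e, card_sdiff_of_subset hsubT, hc3, hT5]
    · -- `V ∖ ((E − x) ∖ T') = W' ∖ C`
      ext a
      constructor
      · intro ha
        rw [mem_sdiff] at ha
        obtain ⟨haV, hnot⟩ := ha
        have haT' : a ∈ T' := by
          by_contra h
          exact hnot (mem_sdiff.2 ⟨hVE haV, h⟩)
        rw [hT', mem_union] at haT'
        rcases haT' with h | h
        · exact h
        · exact absurd haV (hTV _ (hsubT h))
      · intro ha
        rw [mem_sdiff]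
        refine ⟨hPV ha, fun h => (mem_sdiff.1 h).2 ?_⟩
        rw [hT', mem_union]
        exact Or.inl ha
  · intro V' hV' W₁ hW₁ W₂ hW₂
    simp only [Set.mem_setOf_eq, mem_filter] at hW₁ hW₂
    obtain ⟨hCW₁, _, _, _⟩ := hdem' W₁ hW₁.1.1
    obtain ⟨hCW₂, _, _, _⟩ := hdem' W₂ hW₂.1.1
    rw [← sdiff_union_of_subset hCW₁, ← sdiff_union_of_subset hCW₂, ← hW₁.2, ← hW₂.2]


end FiveCore

end PercRepro.Cogirth
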